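import Literature.AlgebraicGeometry.Deformation.InvertibleSheafExtensions
import Literature.AlgebraicGeometry.Modules.CechPicToSheafCohomology
import Literature.AlgebraicGeometry.Modules.UnitCocyclePullback
import Literature.AlgebraicGeometry.Deformation.MorphismLiftsSquareZeroAffine
import HarnessLib

/-!
# Two maps agreeing on a first-order thickening move Čech classes of units by a truncated exponential

Layer `Literature/AlgebraicGeometry/Deformation`, namespace `Literature.AlgebraicGeometry.Deformation`.  THEOREMS ONLY (no
definition, no named fact, no instance, no notation, no `sorry`).  Cell `hodgecm-mathlib` (D-0151), FLOOR-0 P1, F-3 (M)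
child line, grandchild (Mc) N3′ letter S-e (Kodaira–Spencer step), road (M2′) «pair version» of the lead B-p07 (g20)
2026-08-30 21:19Z; author B-p19 (g18).  HC_CM is proved only modulo the 7 printed citations until rung 0 closes; nothing
here is about HC.

## Statements ([Hartshorne2010] §6 proof of Thm. 6.4: the sequence `0 → 𝓘 → 𝒪_{X'}^* → 𝒪_X^* → 0`, `x ↦ 1 + x`, on a
first-order thickening `i : X ⟶ X'`; [Hartshorne1977] III Ex. 4.5: `Pic = Ȟ¹(𝒪^*)` on Čech cocycles)

* `UnitCocycle.exists_toH_eq_map_truncExp_of_app_eq_one` (the heart): a Čech cocycle of units `r` on `X'` whose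
  transition functions are `≡ 1 (mod 𝓘)` is, in `H¹(X', 𝒪^*)`, the truncated exponential of the `𝓘`-valued Čech
  cocycle `r − 1`: `r.toH = H¹(truncExp)(q(x))` with `idealVal x_{xy} = r_{xy} − 1`.
* `UnitCocycle.exists_toH_pullback_eq_add_map_truncExp` (the pair version): for `u₁ u₂ : X' ⟶ Y` agreeing on `X`
  (`i ≫ u₁ = i ≫ u₂`) and a cocycle of units `c` on `Y`,
  `(u₂^* c).toH = (u₁^* c).toH + H¹(truncExp)(q(x))` with `idealVal x_{xy} = u₂♯(c) · u₁♯(c)⁻¹ − 1` (values through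
  `Scheme.Hom.appLE`, no identification of `u₁⁻¹V` with `u₂⁻¹V` needed); the `CechPic.toSheafH` form follows.
* additivity of the `𝓘`-cocycles along a chain `u₁, u₂, u₃` holds already on cochains (`(1+a)(1+b) − 1 = a + b` as
  `𝓘² = 0`), and classes of `𝓘`-cocycles with proportional values are related by any sectionwise-specified
  endomorphism of `𝓘` (naturality of the Čech comparison map, tree `Motives.map_cechToH`).

## References
* [Hartshorne2010] R. Hartshorne, *Deformation Theory*, GTM 257 (2010), §6 proof of Theorem 6.4 (pp. 50–51).
* [Hartshorne1977] R. Hartshorne, *Algebraic Geometry* (1977), III §4 (Čech cohomology), Ex. 4.4, Ex. 4.5.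
-/

noncomputable section

universe u

open CategoryTheory Limits Opposite TopologicalSpace AlgebraicGeometry

open Literature.AlgebraicGeometry.Motives Literature.AlgebraicGeometry.Modules

namespace Literature.AlgebraicGeometry.Deformation

variable {X X' : Scheme.{u}} (i : X ⟶ X') [IsFirstOrderThickening i]

/-! ### The heart: a cocycle of units `≡ 1 (mod 𝓘)` is a truncated exponential in `H¹` -/

/-- **A Čech cocycle of units congruent to `1` modulo `𝓘` is the truncated exponential of an `𝓘`-valued Čech cocycle,
in `H¹(X', 𝒪^*)`.**  For a first-order thickening `i : X ⟶ X'` and a cocycle of units `r` on `X'` with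
`i♯(r_{xy}) = 1` for all its transition functions: there is `x ∈ Ž¹((U_x)_x, 𝓘)` with values `idealVal x_{xy} = r_{xy} − 1`
on `U_x ∩ U_y`, and `r.toH = H¹(truncExp)(q(x))` (`q` = the tree's Čech comparison `cechToH`).  (The cocycle condition for
`x`: `(r_{xy} − 1) + (r_{yz} − 1) − (r_{xz} − 1) = −(r_{xy} − 1)(r_{yz} − 1) = 0` by `𝓘² = 0`.)
[cite: Hartshorne2010, §6 proof of Thm. 6.4, pp. 50–51] [cite: Hartshorne1977, III Ex. 4.5] -/
theorem UnitCocycle.exists_toH_eq_map_truncExp_of_app_eq_one (r : UnitCocycle X')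
    (hr : ∀ (x y : X') (V : X'.Opens) (hx : V ≤ r.U x) (hy : V ≤ r.U y), i.app V (r.g x y V hx hy) = 1) :
    ∃ x : cechOneCocycles (idealSheafAb i) r.U,
      (∀ a b : X', idealVal i (r.U a ⊓ r.U b) ((x : CechOneCochain (idealSheafAb i) r.U) a b) =
        r.g a b (r.U a ⊓ r.U b) inf_le_left inf_le_right - 1) ∧
      r.toH = Sheaf.H.map (truncExp i) 1 (cechToH (idealSheafAb i) r.U r.iSup_U_eq_top x) := by
  classical
  -- the `𝓘`-valued cochain `r − 1`
  have hval : ∀ a b : X', i.app (r.U a ⊓ r.U b) (r.g a b (r.U a ⊓ r.U b) inf_le_left inf_le_right - 1) = 0 := by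
    intro a b
    rw [map_sub, hr, map_one, sub_self]
  let xc : CechOneCochain (idealSheafAb i) r.U := fun a b =>
    (exists_idealVal_eq i (r.U a ⊓ r.U b) _ (hval a b)).choose
  have hxc : ∀ a b : X', idealVal i (r.U a ⊓ r.U b) (xc a b) =
      r.g a b (r.U a ⊓ r.U b) inf_le_left inf_le_right - 1 := fun a b =>
    (exists_idealVal_eq i (r.U a ⊓ r.U b) _ (hval a b)).choose_spec
  -- values of restrictions
  have hres : ∀ (a b : X') {V : X'.Opens} (h : V ≤ r.U a ⊓ r.U b),
      idealVal i V (sheafSecRes (idealSheafAb i) h (xc a b)) = r.g a b V (h.trans inf_le_left) (h.trans inf_le_right) - 1 := by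
    intro a b V h
    rw [← r.map_g a b inf_le_left inf_le_right h, ← map_one (Modules.secRes X' h), ← map_sub, ← hxc]
    exact (secRes_idealVal i h (xc a b)).symm
  -- cocycle condition
  have hcoc : xc ∈ cechOneCocycles (idealSheafAb i) r.U := by
    rw [mem_cechOneCocycles_iff]
    intro a b d
    rw [cechDOne_apply]
    apply idealVal_injective i (r.U a ⊓ r.U b ⊓ r.U d)
    rw [idealVal_add, idealVal_zero]
    have hsub : ∀ (p q : (idealSheafAb i).obj.obj (op (r.U a ⊓ r.U b ⊓ r.U d))),
        idealVal i _ (p - q) = idealVal i _ p - idealVal i _ q := fun p q => by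
      rw [eq_sub_iff_add_eq, ← idealVal_add, sub_add_cancel]
    rw [hsub, hres, hres, hres]
    -- abbreviations on the triple overlap
    have hV : r.U a ⊓ r.U b ⊓ r.U d ≤ r.U a := inf_le_left.trans inf_le_left
    have hmul := r.g_mul a b d (r.U a ⊓ r.U b ⊓ r.U d) hV (inf_le_left.trans inf_le_right) inf_le_right
    -- `(g_ab − 1)(g_bd − 1) = 0` (two values of `𝓘`)
    have hzero : (r.g a b (r.U a ⊓ r.U b ⊓ r.U d) hV (inf_le_left.trans inf_le_right) - 1) *
        (r.g b d (r.U a ⊓ r.U b ⊓ r.U d) (inf_le_left.trans inf_le_right) inf_le_right - 1) = 0 :=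
      mul_eq_zero_of_app_eq_zero i (by rw [map_sub, hr, map_one, sub_self]) (by rw [map_sub, hr, map_one, sub_self])
    linear_combination hmul - hzero
  refine ⟨⟨xc, hcoc⟩, hxc, ?_⟩
  -- the class identity: naturality of `cechToH` under `truncExp`, and `truncExp (r − 1) = r` on cochains
  rw [map_cechToH]
  have hc : cechOneCocyclesMap (truncExp i) r.U ⟨xc, hcoc⟩ = r.cechCocycle := by
    apply Subtype.ext
    rw [cechOneCocyclesMap_coe, UnitCocycle.cechCocycle_coe]
    funext a b
    rw [CechOneCochain.map_apply]
    apply unitsSheafVal_injective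
    rw [UnitCocycle.unitsSheafVal_cechCochain]
    change ((Additive.toMul (((truncExp i).hom.app (op (r.U a ⊓ r.U b))).hom (xc a b)) : (Γ(X', r.U a ⊓ r.U b))ˣ) :
      Γ(X', r.U a ⊓ r.U b)) = _
    rw [truncExp_app_val, hxc, add_sub_cancel]
  rw [hc]
  rfl

/-! ### The pair version: two maps agreeing on `X` -/

/-- Transport of `Scheme.Hom.appLE` along an equality of morphisms. [cite: Hartshorne1977, III Ex. 4.5] -/
private theorem appLE_congr_hom {Y : Scheme.{u}} {w w' : X' ⟶ Y} (e : w = w') (U : Y.Opens) (V : X'.Opens)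
    (h : V ≤ w ⁻¹ᵁ U) (h' : V ≤ w' ⁻¹ᵁ U) (s : Γ(Y, U)) : w.appLE U V h s = w'.appLE U V h' s := by
  subst e
  rfl

/-- `g_{pq} · g_{q'p'} = 1` when `p = p'`, `q = q'` (points given up to propositional equality).
[cite: Hartshorne1977, III Ex. 4.5] -/
private theorem g_mul_g_eq_one_of_eq {Y : Scheme.{u}} (c : UnitCocycle Y) {p p' q q' : Y} (hp : p = p') (hq : q = q')
    (W : Y.Opens) (h₁ : W ≤ c.U p) (h₂ : W ≤ c.U q) (h₃ : W ≤ c.U q') (h₄ : W ≤ c.U p') :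
    c.g p q W h₁ h₂ * c.g q' p' W h₃ h₄ = 1 := by
  subst hp hq
  exact c.g_mul_symm p q W h₁ h₂

/-- **The pair version.**  For a first-order thickening `i : X ⟶ X'`, two morphisms `u₁ u₂ : X' ⟶ Y` which AGREE ON `X`
(`i ≫ u₁ = i ≫ u₂`), and a Čech cocycle of units `c` on `Y`: the quotient cocycle `r := u₂^*c · (u₁^*c)⁻¹` (tree
`UnitCocycle.mul ∕ inv ∕ pullback`, on the intersected cover `u₂⁻¹U ⊓ u₁⁻¹U`) is `≡ 1 (mod 𝓘)`, so there is an `𝓘`-valued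
Čech cocycle `x` with `idealVal x_{ab} = r_{ab} − 1 = u₂♯(c_{ab}) · u₁♯(c_{ba}) − 1` and
`(u₂^*c).toH = (u₁^*c).toH + H¹(truncExp)(q(x))` in `H¹(X', 𝒪^*)` — the classes of the two pull-backs differ by the
truncated exponential of the «difference derivation applied to `dlog c`».  No identification of `u₁⁻¹V` with `u₂⁻¹V` is
used (values through `Scheme.Hom.appLE`). [cite: Hartshorne2010, §6 proof of Thm. 6.4, pp. 50–51] [cite: Hartshorne1977, III Ex. 4.5] -/
theorem UnitCocycle.exists_toH_pullback_eq_add_map_truncExp {Y : Scheme.{u}} (u₁ u₂ : X' ⟶ Y) (hu : i ≫ u₁ = i ≫ u₂)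
    (c : UnitCocycle Y) :
    ∃ x : cechOneCocycles (idealSheafAb i)
        (UnitCocycle.mul (UnitCocycle.pullback u₂ c) (UnitCocycle.inv (UnitCocycle.pullback u₁ c))).U,
      (∀ a b : X', idealVal i _ ((x : CechOneCochain (idealSheafAb i) _) a b) =
        (UnitCocycle.mul (UnitCocycle.pullback u₂ c) (UnitCocycle.inv (UnitCocycle.pullback u₁ c))).g a b _
          inf_le_left inf_le_right - 1) ∧
      (UnitCocycle.pullback u₂ c).toH = (UnitCocycle.pullback u₁ c).toH +
        Sheaf.H.map (truncExp i) 1 (cechToH (idealSheafAb i) _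
          (UnitCocycle.mul (UnitCocycle.pullback u₂ c) (UnitCocycle.inv (UnitCocycle.pullback u₁ c))).iSup_U_eq_top x) := by
  set r := UnitCocycle.mul (UnitCocycle.pullback u₂ c) (UnitCocycle.inv (UnitCocycle.pullback u₁ c)) with hr_def
  haveI : Surjective i := ⟨IsFirstOrderThickening.surjective i⟩
  have hb : u₁.base = u₂.base := base_eq_of_comp_eq i hu
  -- `r ≡ 1 (mod 𝓘)`
  have hr : ∀ (a b : X') (V : X'.Opens) (ha : V ≤ r.U a) (hb' : V ≤ r.U b), i.app V (r.g a b V ha hb') = 1 := by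
    intro a b V ha hb'
    -- the four opens of `Y` and their intersection
    let W : Y.Opens := (c.U (u₂.base a) ⊓ c.U (u₂.base b)) ⊓ (c.U (u₁.base b) ⊓ c.U (u₁.base a))
    have e₂ : V ≤ u₂ ⁻¹ᵁ (c.U (u₂.base a) ⊓ c.U (u₂.base b)) :=
      UnitCocycle.le_preimage_inf u₂ (ha.trans inf_le_left) (hb'.trans inf_le_left)
    have e₁ : V ≤ u₁ ⁻¹ᵁ (c.U (u₁.base b) ⊓ c.U (u₁.base a)) :=
      UnitCocycle.le_preimage_inf u₁ (hb'.trans inf_le_right) (ha.trans inf_le_right)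
    have eW₂ : i ⁻¹ᵁ V ≤ (i ≫ u₂) ⁻¹ᵁ W := by
      intro x hx
      refine ⟨e₂ hx, ?_⟩
      have h1 := e₁ hx
      change i.base x ∈ u₁ ⁻¹ᵁ (c.U (u₁.base b) ⊓ c.U (u₁.base a)) at h1
      change (i ≫ u₂).base x ∈ (c.U (u₁.base b) ⊓ c.U (u₁.base a))
      rw [← hu]
      exact h1
    have eW₁ : i ⁻¹ᵁ V ≤ (i ≫ u₁) ⁻¹ᵁ W := by rw [hu]; exact eW₂
    -- `i♯ ∘ u♯ = (i ≫ u)♯` on `appLE`, then restrict the two sections of `Y` to `W`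
    have key : ∀ (u : X' ⟶ Y) (U' : Y.Opens) (e : V ≤ u ⁻¹ᵁ U') (hW : W ≤ U') (eW : i ⁻¹ᵁ V ≤ (i ≫ u) ⁻¹ᵁ W)
        (s : Γ(Y, U')), i.app V (u.appLE U' V e s) = (i ≫ u).appLE W (i ⁻¹ᵁ V) eW (Modules.secRes Y hW s) := by
      intro u U' e hW eW s
      rw [Scheme.Hom.app_eq_appLE]
      change (u.appLE U' V e ≫ i.appLE V (i ⁻¹ᵁ V) le_rfl) s = (Y.presheaf.map (homOfLE hW).op ≫ (i ≫ u).appLE W _ eW) s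
      rw [Scheme.Hom.appLE_comp_appLE, Scheme.Hom.map_appLE]
    change i.app V (u₂.appLE _ V e₂ (c.g (u₂.base a) (u₂.base b) _ inf_le_left inf_le_right) *
      u₁.appLE _ V e₁ (c.g (u₁.base b) (u₁.base a) _ inf_le_left inf_le_right)) = 1
    rw [map_mul, key u₂ _ e₂ inf_le_left eW₂, key u₁ _ e₁ inf_le_right eW₁, c.map_g, c.map_g,
      appLE_congr_hom hu W (i ⁻¹ᵁ V) eW₁ eW₂, ← map_mul,
      g_mul_g_eq_one_of_eq c (congrArg (fun f => f a) hb).symm (congrArg (fun f => f b) hb).symm, map_one]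
  obtain ⟨x, hx, hclass⟩ := UnitCocycle.exists_toH_eq_map_truncExp_of_app_eq_one i r hr
  refine ⟨x, hx, ?_⟩
  -- `[u₂^*c] = [r] · [u₁^*c]` in `CechPic`, then `toSheafH`
  have hmk : CechPic.mk (UnitCocycle.pullback u₂ c) = CechPic.mk r * CechPic.mk (UnitCocycle.pullback u₁ c) := by
    rw [hr_def, CechPic.mk_mul, CechPic.mk_inv, inv_mul_cancel_right]
  have h2 : (UnitCocycle.pullback u₂ c).toH = r.toH + (UnitCocycle.pullback u₁ c).toH := by
    rw [← CechPic.toAdd_toSheafH_mk, hmk, map_mul, toAdd_mul, CechPic.toAdd_toSheafH_mk, CechPic.toAdd_toSheafH_mk]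
  rw [h2, hclass, add_comm]

/-! ### Cover independence, chain additivity, scalars -/

/-- A point-indexed family of opens with `a ∈ U a` covers. [cite: Hartshorne1977, III Ex. 4.4 (b)] -/
private theorem iSup_eq_top_of_mem {U : X' → X'.Opens} (hU : ∀ a, a ∈ U a) : iSup U = ⊤ :=
  top_le_iff.mp fun x _ => Opens.mem_iSup.2 ⟨x, hU x⟩

omit [IsFirstOrderThickening i] in
/-- Values of restrictions of an `𝓘`-cocycle presented as `r − 1`. [cite: Hartshorne1977, III Ex. 4.5] -/
private theorem idealVal_sheafSecRes_of_eq (r : UnitCocycle X') (x : CechOneCochain (idealSheafAb i) r.U)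
    (hx : ∀ a b : X', idealVal i (r.U a ⊓ r.U b) (x a b) = r.g a b (r.U a ⊓ r.U b) inf_le_left inf_le_right - 1)
    (a b : X') {V : X'.Opens} (h : V ≤ r.U a ⊓ r.U b) :
    idealVal i V (sheafSecRes (idealSheafAb i) h (x a b)) = r.g a b V (h.trans inf_le_left) (h.trans inf_le_right) - 1 := by
  rw [← r.map_g a b inf_le_left inf_le_right h, ← map_one (Modules.secRes X' h), ← map_sub, ← hx]
  exact (secRes_idealVal i h (x a b)).symm

omit [IsFirstOrderThickening i] in
/-- **Cover independence for `𝓘`-cocycles on point-indexed covers**: two Čech `1`-cocycles of `𝓘` on covers `(U_a)`,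
`(U'_a)` (with `a ∈ U_a`, `a ∈ U'_a`) whose values agree on `(U_a ∩ U'_a) ∩ (U_b ∩ U'_b)` have the same class in `H¹(X', 𝓘)`
(refine both to the intersected cover; tree `Motives.cechToH_eq_of_refine_sub_refine_mem`).
[cite: Hartshorne1977, III Ex. 4.4 (b)] -/
theorem cechToH_eq_of_secRes_idealVal_eq {U U' : X' → X'.Opens} (hU : ∀ a, a ∈ U a) (hU' : ∀ a, a ∈ U' a)
    (x : cechOneCocycles (idealSheafAb i) U) (x' : cechOneCocycles (idealSheafAb i) U')
    (h : ∀ a b : X',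
      Modules.secRes X' (inf_le_inf inf_le_left inf_le_left : (U a ⊓ U' a) ⊓ (U b ⊓ U' b) ≤ U a ⊓ U b)
          (idealVal i _ ((x : CechOneCochain (idealSheafAb i) U) a b)) =
        Modules.secRes X' (inf_le_inf inf_le_right inf_le_right : (U a ⊓ U' a) ⊓ (U b ⊓ U' b) ≤ U' a ⊓ U' b)
          (idealVal i _ ((x' : CechOneCochain (idealSheafAb i) U') a b))) :
    cechToH (idealSheafAb i) U (iSup_eq_top_of_mem hU) x = cechToH (idealSheafAb i) U' (iSup_eq_top_of_mem hU') x' := by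
  refine cechToH_eq_of_refine_sub_refine_mem (idealSheafAb i) U U' (fun a => U a ⊓ U' a) id id
    (fun a => inf_le_left) (fun a => inf_le_right) _ _ (iSup_eq_top_of_mem fun a => ⟨hU a, hU' a⟩) x x' ?_
  have h0 : (CechOneCochain.refine (idealSheafAb i) U (fun a => U a ⊓ U' a) id (fun a => inf_le_left) x :
      CechOneCochain (idealSheafAb i) fun a => U a ⊓ U' a) =
      CechOneCochain.refine (idealSheafAb i) U' (fun a => U a ⊓ U' a) id (fun a => inf_le_right) x' := by
    funext a b
    rw [CechOneCochain.refine_apply, CechOneCochain.refine_apply]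
    apply idealVal_injective i
    rw [← secRes_idealVal, ← secRes_idealVal]
    exact h a b
  rw [h0, sub_self]
  exact zero_mem _

/-- **Chain additivity (S3″a).**  For three morphisms `u₁ u₂ u₃ : X' ⟶ Y` and a cocycle of units `c` on `Y`, any
`𝓘`-cocycles presenting the quotients `u₂^*c/u₁^*c`, `u₃^*c/u₂^*c`, `u₃^*c/u₁^*c` as in the pair theorem have classes
adding up: `q(x₁₃) = q(x₁₂) + q(x₂₃)` in `H¹(X', 𝓘)` — on cochains `(1 + a)(1 + b) − 1 = a + b` because `ab ∈ 𝓘² = 0`.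
[cite: Hartshorne2010, §6 proof of Thm. 6.4, pp. 50–51] [cite: Hartshorne1977, III Ex. 4.4 (b)] -/
theorem cechToH_chain_add {Y : Scheme.{u}} (u₁ u₂ u₃ : X' ⟶ Y) (c : UnitCocycle Y)
    (x₁₂ : cechOneCocycles (idealSheafAb i)
      (UnitCocycle.mul (UnitCocycle.pullback u₂ c) (UnitCocycle.inv (UnitCocycle.pullback u₁ c))).U)
    (x₂₃ : cechOneCocycles (idealSheafAb i)
      (UnitCocycle.mul (UnitCocycle.pullback u₃ c) (UnitCocycle.inv (UnitCocycle.pullback u₂ c))).U)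
    (x₁₃ : cechOneCocycles (idealSheafAb i)
      (UnitCocycle.mul (UnitCocycle.pullback u₃ c) (UnitCocycle.inv (UnitCocycle.pullback u₁ c))).U)
    (h₁₂ : ∀ a b : X', idealVal i _ ((x₁₂ : CechOneCochain (idealSheafAb i) _) a b) =
      (UnitCocycle.mul (UnitCocycle.pullback u₂ c) (UnitCocycle.inv (UnitCocycle.pullback u₁ c))).g a b _
        inf_le_left inf_le_right - 1)
    (h₂₃ : ∀ a b : X', idealVal i _ ((x₂₃ : CechOneCochain (idealSheafAb i) _) a b) =
      (UnitCocycle.mul (UnitCocycle.pullback u₃ c) (UnitCocycle.inv (UnitCocycle.pullback u₂ c))).g a b _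
        inf_le_left inf_le_right - 1)
    (h₁₃ : ∀ a b : X', idealVal i _ ((x₁₃ : CechOneCochain (idealSheafAb i) _) a b) =
      (UnitCocycle.mul (UnitCocycle.pullback u₃ c) (UnitCocycle.inv (UnitCocycle.pullback u₁ c))).g a b _
        inf_le_left inf_le_right - 1) :
    cechToH (idealSheafAb i) _
        (UnitCocycle.mul (UnitCocycle.pullback u₃ c) (UnitCocycle.inv (UnitCocycle.pullback u₁ c))).iSup_U_eq_top x₁₃ =
      cechToH (idealSheafAb i) _
        (UnitCocycle.mul (UnitCocycle.pullback u₂ c) (UnitCocycle.inv (UnitCocycle.pullback u₁ c))).iSup_U_eq_top x₁₂ +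
      cechToH (idealSheafAb i) _
        (UnitCocycle.mul (UnitCocycle.pullback u₃ c) (UnitCocycle.inv (UnitCocycle.pullback u₂ c))).iSup_U_eq_top x₂₃ := by
  -- the sum of the refinements of `x₁₂`, `x₂₃` to the intersected cover `W`
  let W : X' → X'.Opens := fun a => (UnitCocycle.mul (UnitCocycle.pullback u₂ c) (UnitCocycle.inv (UnitCocycle.pullback u₁ c))).U a ⊓ (UnitCocycle.mul (UnitCocycle.pullback u₃ c) (UnitCocycle.inv (UnitCocycle.pullback u₂ c))).U a
  have hW : ∀ a, a ∈ W a := fun a => ⟨(UnitCocycle.mul (UnitCocycle.pullback u₂ c) (UnitCocycle.inv (UnitCocycle.pullback u₁ c))).mem a, (UnitCocycle.mul (UnitCocycle.pullback u₃ c) (UnitCocycle.inv (UnitCocycle.pullback u₂ c))).mem a⟩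
  let y : cechOneCocycles (idealSheafAb i) W :=
    cechOneCocyclesRefine (idealSheafAb i) (UnitCocycle.mul (UnitCocycle.pullback u₂ c) (UnitCocycle.inv (UnitCocycle.pullback u₁ c))).U W id (fun a => inf_le_left) x₁₂ +
      cechOneCocyclesRefine (idealSheafAb i) (UnitCocycle.mul (UnitCocycle.pullback u₃ c) (UnitCocycle.inv (UnitCocycle.pullback u₂ c))).U W id (fun a => inf_le_right) x₂₃
  have hy : cechToH (idealSheafAb i) W (iSup_eq_top_of_mem hW) y =
      cechToH (idealSheafAb i) _ (UnitCocycle.mul (UnitCocycle.pullback u₂ c) (UnitCocycle.inv (UnitCocycle.pullback u₁ c))).iSup_U_eq_top x₁₂ + cechToH (idealSheafAb i) _ (UnitCocycle.mul (UnitCocycle.pullback u₃ c) (UnitCocycle.inv (UnitCocycle.pullback u₂ c))).iSup_U_eq_top x₂₃ := by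
    rw [map_add, cechToH_refine, cechToH_refine]
  rw [← hy]
  symm
  -- compare `y` with `x₁₃` on the common intersections
  refine cechToH_eq_of_secRes_idealVal_eq i hW (UnitCocycle.mul (UnitCocycle.pullback u₃ c) (UnitCocycle.inv (UnitCocycle.pullback u₁ c))).mem y x₁₃ fun a b => ?_
  -- name the common open and the five transition functions on it
  have hQ₁ : (W a ⊓ (UnitCocycle.mul (UnitCocycle.pullback u₃ c) (UnitCocycle.inv (UnitCocycle.pullback u₁ c))).U a) ⊓ (W b ⊓ (UnitCocycle.mul (UnitCocycle.pullback u₃ c) (UnitCocycle.inv (UnitCocycle.pullback u₁ c))).U b) ≤ W a ⊓ W b := inf_le_inf inf_le_left inf_le_left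
  have hQ₂ : (W a ⊓ (UnitCocycle.mul (UnitCocycle.pullback u₃ c) (UnitCocycle.inv (UnitCocycle.pullback u₁ c))).U a) ⊓ (W b ⊓ (UnitCocycle.mul (UnitCocycle.pullback u₃ c) (UnitCocycle.inv (UnitCocycle.pullback u₁ c))).U b) ≤ (UnitCocycle.mul (UnitCocycle.pullback u₃ c) (UnitCocycle.inv (UnitCocycle.pullback u₁ c))).U a ⊓ (UnitCocycle.mul (UnitCocycle.pullback u₃ c) (UnitCocycle.inv (UnitCocycle.pullback u₁ c))).U b := inf_le_inf inf_le_right inf_le_right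
  rw [secRes_idealVal, secRes_idealVal]
  change idealVal i _ (sheafSecRes (idealSheafAb i) hQ₁ ((y : CechOneCochain (idealSheafAb i) W) a b)) =
    idealVal i _ (sheafSecRes (idealSheafAb i) hQ₂ ((x₁₃ : CechOneCochain (idealSheafAb i) _) a b))
  rw [idealVal_sheafSecRes_of_eq i (UnitCocycle.mul (UnitCocycle.pullback u₃ c) (UnitCocycle.inv (UnitCocycle.pullback u₁ c))) x₁₃ h₁₃ a b hQ₂]
  have hyab : ((y : CechOneCochain (idealSheafAb i) W) a b) =
      sheafSecRes (idealSheafAb i) (inf_le_inf inf_le_left inf_le_left : W a ⊓ W b ≤ (UnitCocycle.mul (UnitCocycle.pullback u₂ c) (UnitCocycle.inv (UnitCocycle.pullback u₁ c))).U a ⊓ (UnitCocycle.mul (UnitCocycle.pullback u₂ c) (UnitCocycle.inv (UnitCocycle.pullback u₁ c))).U b)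
          ((x₁₂ : CechOneCochain (idealSheafAb i) _) a b) +
        sheafSecRes (idealSheafAb i) (inf_le_inf inf_le_right inf_le_right : W a ⊓ W b ≤ (UnitCocycle.mul (UnitCocycle.pullback u₃ c) (UnitCocycle.inv (UnitCocycle.pullback u₂ c))).U a ⊓ (UnitCocycle.mul (UnitCocycle.pullback u₃ c) (UnitCocycle.inv (UnitCocycle.pullback u₂ c))).U b)
          ((x₂₃ : CechOneCochain (idealSheafAb i) _) a b) := rfl
  rw [hyab, map_add, idealVal_add, sheafSecRes_sheafSecRes, sheafSecRes_sheafSecRes,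
    idealVal_sheafSecRes_of_eq i (UnitCocycle.mul (UnitCocycle.pullback u₂ c) (UnitCocycle.inv (UnitCocycle.pullback u₁ c))) x₁₂ h₁₂ a b, idealVal_sheafSecRes_of_eq i (UnitCocycle.mul (UnitCocycle.pullback u₃ c) (UnitCocycle.inv (UnitCocycle.pullback u₂ c))) x₂₃ h₂₃ a b]
  -- the algebra `(A − 1) + (B − 1) = C − 1`
  set Q : X'.Opens := (W a ⊓ (UnitCocycle.mul (UnitCocycle.pullback u₃ c) (UnitCocycle.inv (UnitCocycle.pullback u₁ c))).U a) ⊓ (W b ⊓ (UnitCocycle.mul (UnitCocycle.pullback u₃ c) (UnitCocycle.inv (UnitCocycle.pullback u₁ c))).U b) with hQdef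
  have hQa₁ : Q ≤ (UnitCocycle.pullback u₁ c).U a := (hQ₂.trans inf_le_left).trans inf_le_right
  have hQb₁ : Q ≤ (UnitCocycle.pullback u₁ c).U b := (hQ₂.trans inf_le_right).trans inf_le_right
  have hQa₂ : Q ≤ (UnitCocycle.pullback u₂ c).U a := ((hQ₁.trans inf_le_left).trans inf_le_left).trans inf_le_left
  have hQb₂ : Q ≤ (UnitCocycle.pullback u₂ c).U b := ((hQ₁.trans inf_le_right).trans inf_le_left).trans inf_le_left
  have hQa₃ : Q ≤ (UnitCocycle.pullback u₃ c).U a := (hQ₂.trans inf_le_left).trans inf_le_left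
  have hQb₃ : Q ≤ (UnitCocycle.pullback u₃ c).U b := (hQ₂.trans inf_le_right).trans inf_le_left
  have h22 := (UnitCocycle.pullback u₂ c).g_mul_symm a b Q hQa₂ hQb₂
  have hzero : ((UnitCocycle.mul (UnitCocycle.pullback u₂ c) (UnitCocycle.inv (UnitCocycle.pullback u₁ c))).g a b Q (hQ₁.trans (inf_le_inf inf_le_left inf_le_left) |>.trans inf_le_left)
        (hQ₁.trans (inf_le_inf inf_le_left inf_le_left) |>.trans inf_le_right) - 1) *
      ((UnitCocycle.mul (UnitCocycle.pullback u₃ c) (UnitCocycle.inv (UnitCocycle.pullback u₂ c))).g a b Q (hQ₁.trans (inf_le_inf inf_le_right inf_le_right) |>.trans inf_le_left)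
        (hQ₁.trans (inf_le_inf inf_le_right inf_le_right) |>.trans inf_le_right) - 1) = 0 := by
    refine mul_eq_zero_of_app_eq_zero i ?_ ?_
    · have e := app_idealVal i Q (sheafSecRes (idealSheafAb i)
        (hQ₁.trans (inf_le_inf inf_le_left inf_le_left)) ((x₁₂ : CechOneCochain (idealSheafAb i) _) a b))
      rwa [idealVal_sheafSecRes_of_eq i (UnitCocycle.mul (UnitCocycle.pullback u₂ c) (UnitCocycle.inv (UnitCocycle.pullback u₁ c))) x₁₂ h₁₂ a b] at e
    · have e := app_idealVal i Q (sheafSecRes (idealSheafAb i)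
        (hQ₁.trans (inf_le_inf inf_le_right inf_le_right)) ((x₂₃ : CechOneCochain (idealSheafAb i) _) a b))
      rwa [idealVal_sheafSecRes_of_eq i (UnitCocycle.mul (UnitCocycle.pullback u₃ c) (UnitCocycle.inv (UnitCocycle.pullback u₂ c))) x₂₃ h₂₃ a b] at e
  change ((UnitCocycle.pullback u₂ c).g a b Q hQa₂ hQb₂ * (UnitCocycle.pullback u₁ c).g b a Q hQb₁ hQa₁ - 1) *
      ((UnitCocycle.pullback u₃ c).g a b Q hQa₃ hQb₃ * (UnitCocycle.pullback u₂ c).g b a Q hQb₂ hQa₂ - 1) = 0 at hzero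
  change (UnitCocycle.pullback u₂ c).g a b Q hQa₂ hQb₂ * (UnitCocycle.pullback u₁ c).g b a Q hQb₁ hQa₁ - 1 +
      ((UnitCocycle.pullback u₃ c).g a b Q hQa₃ hQb₃ * (UnitCocycle.pullback u₂ c).g b a Q hQb₂ hQa₂ - 1) =
    (UnitCocycle.pullback u₃ c).g a b Q hQa₃ hQb₃ * (UnitCocycle.pullback u₁ c).g b a Q hQb₁ hQa₁ - 1
  linear_combination (-1 : Γ(X', Q)) * hzero +
    ((UnitCocycle.pullback u₁ c).g b a Q hQb₁ hQa₁ * (UnitCocycle.pullback u₃ c).g a b Q hQa₃ hQb₃) * h22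

omit [IsFirstOrderThickening i] in
/-- **Scalars (S3″b).**  For two pairs `(u₁, u₂)`, `(u₁, u₂')` and a cocycle of units `c` on `Y` whose difference
derivations are PROPORTIONAL on the transition functions — `u₂'♯(c) − u₁♯(c) = f · (u₂♯(c) − u₁♯(c))` for a global
function `f ∈ Γ(X', 𝒪)` — the two `𝓘`-cocycles of the pair theorem have classes related by ANY endomorphism `μ` of `𝓘`
acting as multiplication by `f` on values: `q(x') = H¹(μ)(q(x))` (values: `p₂'q₁ − 1 = f (p₂q₁ − 1)` from `p₁q₁ = 1`;
classes: naturality `Motives.map_cechToH` and cover independence).  This is the `Γ(𝒪)`-linearity in the derivation.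
[cite: Hartshorne2010, §6 proof of Thm. 6.4, pp. 50–51] [cite: Hartshorne1977, III Lemma 4.4, Ex. 4.4 (b)] -/
theorem cechToH_eq_map_of_sub_eq_mul_sub {Y : Scheme.{u}} (u₁ u₂ u₂' : X' ⟶ Y) (c : UnitCocycle Y) (f : Γ(X', ⊤))
    (μ : idealSheafAb i ⟶ idealSheafAb i)
    (hμ : ∀ (U : X'.Opens) (y : (idealSheafAb i).obj.obj (op U)),
      idealVal i U ((μ.hom.app (op U)).hom y) = Modules.secRes X' le_top f * idealVal i U y)
    (hprop : ∀ (a b : X') (V : X'.Opens) (h₁a : V ≤ (UnitCocycle.pullback u₁ c).U a)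
      (h₁b : V ≤ (UnitCocycle.pullback u₁ c).U b) (h₂a : V ≤ (UnitCocycle.pullback u₂ c).U a)
      (h₂b : V ≤ (UnitCocycle.pullback u₂ c).U b) (h₂'a : V ≤ (UnitCocycle.pullback u₂' c).U a)
      (h₂'b : V ≤ (UnitCocycle.pullback u₂' c).U b),
      (UnitCocycle.pullback u₂' c).g a b V h₂'a h₂'b - (UnitCocycle.pullback u₁ c).g a b V h₁a h₁b =
        Modules.secRes X' le_top f *
          ((UnitCocycle.pullback u₂ c).g a b V h₂a h₂b - (UnitCocycle.pullback u₁ c).g a b V h₁a h₁b))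
    (x : cechOneCocycles (idealSheafAb i) (UnitCocycle.mul (UnitCocycle.pullback u₂ c) (UnitCocycle.inv (UnitCocycle.pullback u₁ c))).U) (x' : cechOneCocycles (idealSheafAb i) (UnitCocycle.mul (UnitCocycle.pullback u₂' c) (UnitCocycle.inv (UnitCocycle.pullback u₁ c))).U)
    (hx : ∀ a b : X', idealVal i _ ((x : CechOneCochain (idealSheafAb i) _) a b) =
      (UnitCocycle.mul (UnitCocycle.pullback u₂ c) (UnitCocycle.inv (UnitCocycle.pullback u₁ c))).g a b _ inf_le_left inf_le_right - 1)
    (hx' : ∀ a b : X', idealVal i _ ((x' : CechOneCochain (idealSheafAb i) _) a b) =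
      (UnitCocycle.mul (UnitCocycle.pullback u₂' c) (UnitCocycle.inv (UnitCocycle.pullback u₁ c))).g a b _ inf_le_left inf_le_right - 1) :
    cechToH (idealSheafAb i) _ (UnitCocycle.mul (UnitCocycle.pullback u₂' c) (UnitCocycle.inv (UnitCocycle.pullback u₁ c))).iSup_U_eq_top x' =
      Sheaf.H.map μ 1 (cechToH (idealSheafAb i) _ (UnitCocycle.mul (UnitCocycle.pullback u₂ c) (UnitCocycle.inv (UnitCocycle.pullback u₁ c))).iSup_U_eq_top x) := by
  rw [map_cechToH]
  refine cechToH_eq_of_secRes_idealVal_eq i (UnitCocycle.mul (UnitCocycle.pullback u₂' c) (UnitCocycle.inv (UnitCocycle.pullback u₁ c))).mem (UnitCocycle.mul (UnitCocycle.pullback u₂ c) (UnitCocycle.inv (UnitCocycle.pullback u₁ c))).mem x' (cechOneCocyclesMap μ _ x) fun a b => ?_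
  have hQ₁ : ((UnitCocycle.mul (UnitCocycle.pullback u₂' c) (UnitCocycle.inv (UnitCocycle.pullback u₁ c))).U a ⊓ (UnitCocycle.mul (UnitCocycle.pullback u₂ c) (UnitCocycle.inv (UnitCocycle.pullback u₁ c))).U a) ⊓ ((UnitCocycle.mul (UnitCocycle.pullback u₂' c) (UnitCocycle.inv (UnitCocycle.pullback u₁ c))).U b ⊓ (UnitCocycle.mul (UnitCocycle.pullback u₂ c) (UnitCocycle.inv (UnitCocycle.pullback u₁ c))).U b) ≤ (UnitCocycle.mul (UnitCocycle.pullback u₂' c) (UnitCocycle.inv (UnitCocycle.pullback u₁ c))).U a ⊓ (UnitCocycle.mul (UnitCocycle.pullback u₂' c) (UnitCocycle.inv (UnitCocycle.pullback u₁ c))).U b := inf_le_inf inf_le_left inf_le_left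
  have hQ₂ : ((UnitCocycle.mul (UnitCocycle.pullback u₂' c) (UnitCocycle.inv (UnitCocycle.pullback u₁ c))).U a ⊓ (UnitCocycle.mul (UnitCocycle.pullback u₂ c) (UnitCocycle.inv (UnitCocycle.pullback u₁ c))).U a) ⊓ ((UnitCocycle.mul (UnitCocycle.pullback u₂' c) (UnitCocycle.inv (UnitCocycle.pullback u₁ c))).U b ⊓ (UnitCocycle.mul (UnitCocycle.pullback u₂ c) (UnitCocycle.inv (UnitCocycle.pullback u₁ c))).U b) ≤ (UnitCocycle.mul (UnitCocycle.pullback u₂ c) (UnitCocycle.inv (UnitCocycle.pullback u₁ c))).U a ⊓ (UnitCocycle.mul (UnitCocycle.pullback u₂ c) (UnitCocycle.inv (UnitCocycle.pullback u₁ c))).U b := inf_le_inf inf_le_right inf_le_right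
  rw [cechOneCocyclesMap_coe, CechOneCochain.map_apply, hμ, map_mul, Modules.secRes_secRes, secRes_idealVal,
    secRes_idealVal]
  change idealVal i _ (sheafSecRes (idealSheafAb i) hQ₁ ((x' : CechOneCochain (idealSheafAb i) _) a b)) =
    Modules.secRes X' le_top f * idealVal i _ (sheafSecRes (idealSheafAb i) hQ₂ ((x : CechOneCochain (idealSheafAb i) _) a b))
  rw [idealVal_sheafSecRes_of_eq i (UnitCocycle.mul (UnitCocycle.pullback u₂' c) (UnitCocycle.inv (UnitCocycle.pullback u₁ c))) x' hx' a b hQ₁, idealVal_sheafSecRes_of_eq i (UnitCocycle.mul (UnitCocycle.pullback u₂ c) (UnitCocycle.inv (UnitCocycle.pullback u₁ c))) x hx a b hQ₂]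
  -- the algebra `p₂'q₁ − 1 = f (p₂q₁ − 1)` from `p₂' − p₁ = f (p₂ − p₁)` and `p₁q₁ = 1`
  have hQa₁ : ((UnitCocycle.mul (UnitCocycle.pullback u₂' c) (UnitCocycle.inv (UnitCocycle.pullback u₁ c))).U a ⊓ (UnitCocycle.mul (UnitCocycle.pullback u₂ c) (UnitCocycle.inv (UnitCocycle.pullback u₁ c))).U a) ⊓ ((UnitCocycle.mul (UnitCocycle.pullback u₂' c) (UnitCocycle.inv (UnitCocycle.pullback u₁ c))).U b ⊓ (UnitCocycle.mul (UnitCocycle.pullback u₂ c) (UnitCocycle.inv (UnitCocycle.pullback u₁ c))).U b) ≤ (UnitCocycle.pullback u₁ c).U a :=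
    (hQ₂.trans inf_le_left).trans inf_le_right
  have hQb₁ : ((UnitCocycle.mul (UnitCocycle.pullback u₂' c) (UnitCocycle.inv (UnitCocycle.pullback u₁ c))).U a ⊓ (UnitCocycle.mul (UnitCocycle.pullback u₂ c) (UnitCocycle.inv (UnitCocycle.pullback u₁ c))).U a) ⊓ ((UnitCocycle.mul (UnitCocycle.pullback u₂' c) (UnitCocycle.inv (UnitCocycle.pullback u₁ c))).U b ⊓ (UnitCocycle.mul (UnitCocycle.pullback u₂ c) (UnitCocycle.inv (UnitCocycle.pullback u₁ c))).U b) ≤ (UnitCocycle.pullback u₁ c).U b :=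
    (hQ₂.trans inf_le_right).trans inf_le_right
  have hQa₂ : ((UnitCocycle.mul (UnitCocycle.pullback u₂' c) (UnitCocycle.inv (UnitCocycle.pullback u₁ c))).U a ⊓ (UnitCocycle.mul (UnitCocycle.pullback u₂ c) (UnitCocycle.inv (UnitCocycle.pullback u₁ c))).U a) ⊓ ((UnitCocycle.mul (UnitCocycle.pullback u₂' c) (UnitCocycle.inv (UnitCocycle.pullback u₁ c))).U b ⊓ (UnitCocycle.mul (UnitCocycle.pullback u₂ c) (UnitCocycle.inv (UnitCocycle.pullback u₁ c))).U b) ≤ (UnitCocycle.pullback u₂ c).U a :=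
    (hQ₂.trans inf_le_left).trans inf_le_left
  have hQb₂ : ((UnitCocycle.mul (UnitCocycle.pullback u₂' c) (UnitCocycle.inv (UnitCocycle.pullback u₁ c))).U a ⊓ (UnitCocycle.mul (UnitCocycle.pullback u₂ c) (UnitCocycle.inv (UnitCocycle.pullback u₁ c))).U a) ⊓ ((UnitCocycle.mul (UnitCocycle.pullback u₂' c) (UnitCocycle.inv (UnitCocycle.pullback u₁ c))).U b ⊓ (UnitCocycle.mul (UnitCocycle.pullback u₂ c) (UnitCocycle.inv (UnitCocycle.pullback u₁ c))).U b) ≤ (UnitCocycle.pullback u₂ c).U b :=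
    (hQ₂.trans inf_le_right).trans inf_le_left
  have hQa₂' : ((UnitCocycle.mul (UnitCocycle.pullback u₂' c) (UnitCocycle.inv (UnitCocycle.pullback u₁ c))).U a ⊓ (UnitCocycle.mul (UnitCocycle.pullback u₂ c) (UnitCocycle.inv (UnitCocycle.pullback u₁ c))).U a) ⊓ ((UnitCocycle.mul (UnitCocycle.pullback u₂' c) (UnitCocycle.inv (UnitCocycle.pullback u₁ c))).U b ⊓ (UnitCocycle.mul (UnitCocycle.pullback u₂ c) (UnitCocycle.inv (UnitCocycle.pullback u₁ c))).U b) ≤ (UnitCocycle.pullback u₂' c).U a :=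
    (hQ₁.trans inf_le_left).trans inf_le_left
  have hQb₂' : ((UnitCocycle.mul (UnitCocycle.pullback u₂' c) (UnitCocycle.inv (UnitCocycle.pullback u₁ c))).U a ⊓ (UnitCocycle.mul (UnitCocycle.pullback u₂ c) (UnitCocycle.inv (UnitCocycle.pullback u₁ c))).U a) ⊓ ((UnitCocycle.mul (UnitCocycle.pullback u₂' c) (UnitCocycle.inv (UnitCocycle.pullback u₁ c))).U b ⊓ (UnitCocycle.mul (UnitCocycle.pullback u₂ c) (UnitCocycle.inv (UnitCocycle.pullback u₁ c))).U b) ≤ (UnitCocycle.pullback u₂' c).U b :=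
    (hQ₁.trans inf_le_right).trans inf_le_left
  have h11 := (UnitCocycle.pullback u₁ c).g_mul_symm a b _ hQa₁ hQb₁
  have hp := hprop a b _ hQa₁ hQb₁ hQa₂ hQb₂ hQa₂' hQb₂'
  change (UnitCocycle.pullback u₂' c).g a b _ hQa₂' hQb₂' * (UnitCocycle.pullback u₁ c).g b a _ hQb₁ hQa₁ - 1 =
    Modules.secRes X' le_top f *
      ((UnitCocycle.pullback u₂ c).g a b _ hQa₂ hQb₂ * (UnitCocycle.pullback u₁ c).g b a _ hQb₁ hQa₁ - 1)
  linear_combination (UnitCocycle.pullback u₁ c).g b a _ hQb₁ hQa₁ * hp +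
    (1 - Modules.secRes X' (le_top : ((UnitCocycle.mul (UnitCocycle.pullback u₂' c) (UnitCocycle.inv (UnitCocycle.pullback u₁ c))).U a ⊓ (UnitCocycle.mul (UnitCocycle.pullback u₂ c) (UnitCocycle.inv (UnitCocycle.pullback u₁ c))).U a) ⊓ ((UnitCocycle.mul (UnitCocycle.pullback u₂' c) (UnitCocycle.inv (UnitCocycle.pullback u₁ c))).U b ⊓ (UnitCocycle.mul (UnitCocycle.pullback u₂ c) (UnitCocycle.inv (UnitCocycle.pullback u₁ c))).U b) ≤ ⊤) f) * h11

end Literature.AlgebraicGeometry.Deformation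

end
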